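import Summits.QuantumFields.BalabanUV.Beta.WilsonWardSocketFit
import Summits.QuantumFields.BalabanUV.Beta.D1BFx.CombBorderPairSlotLetter
import Summits.QuantumFields.BalabanUV.Beta.D1BFx.ColumnGaugeCombPartner

/-!
# `BalabanUV.Beta.D1BFx.CombPairSlotLetters` — road «BF-x», binder row D1, PART 24 HEAD (H2-letters) (`PART24-HEAD-SPEC-g24.md` §2): **THE LITERAL OF RECORD's
# PAIR TABLE OBEYS TT12's ∕ TT15's THREE POINTWISE LETTERS WITH ONE SCALAR `ξ = n⁴∕2`, PARTNERS `T = T′ = S♭`, `𝕄 = bhK + Dsh`** — for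
# `S₂⁰ κ u κ′ u′ = n⁸ • wilsonW₂ 3 ((8N²)⁻¹ • wsym22 N) κ u κ′ u′ + (−n¹²∕4) • symVh₂SAn1 3 n κ u κ′ u′` (TT8 `JsB12CombSh0_W_zero_eq` at lockB `cB = −n¹²∕4`) and
# `S♭ κ u = n⁴ • wilsonA 3 κ u + (−n⁸∕2) • symVhSAt ρ_c 3 n κ u`:
# `hL : divV (κ u ↦ S₂⁰ κ u κ′ u′) u₀ = (n⁴∕2) • conjV (S♭ κ′ u′) (diagK (legInd ρ_c u₀))`, `hR : divV (S₂⁰ κ u) u₀ = (n⁴∕2) • conjV (S♭ κ u) (diagK (legInd ρ_c u₀))`,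
# `hT : divV S♭ u₀ = (n⁴∕2) • conjV (bhK n + Dsh n) (diagK (legInd ρ_c u₀))` — Wilson sector by leaf-09's pointwise laws (colour data displayed), border sector by
# `CombBorderPairSlotLetter`, `hT` by `ColumnGaugeCombPartner` and the gauge-nullity of the Λ-sector (`CombLamSectorLetters`).

HONEST DEPENDENCY (cell records, verbatim): «continuum YM on T⁴ ⇐ BetaPertH ∧ nine spine estimates (0/9 proved); BetaPertH ⇐ (D1) ∧ (D4) ∧
CAP+tail; G-an2-4 gates asym, D1 and NE2/3/4.»  HONEST FRAMING (cell contract, verbatim): «discharging `BetaPertH` makes Bałaban's UV stability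
UNCONDITIONAL — a real constructive-QFT result; it is NOT the continuum limit and NOT the Clay problem.»  THIS MODULE DISCHARGES NO binder of row D1 and
NO estimate of Bałaban's: [folklore] scalar bookkeeping over landed pointwise laws BY NAME (leaf-09's `WilsonBiStencilWardZ.divV_wilsonW₂_wsym22_eq_conjV` ∕
`WilsonBiStencilWardSocket.divV_wilsonW₂_wsym22_snd_eq_conjV` under their displayed colour data `Complete τ`, `TrOrthonormal τ`, `N ≠ 0`; this lineage's
`CombBorderPairSlotLetter` and `ColumnGaugeCombPartner`; an2∕leaf-05's `CombLamSectorLetters.divV_SLam_lamCoeffOf_an1TablesS2_eq_zero`).  No definition, no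
`def … : Prop`, nothing cited, 0 sorry.  The colour data are HYPOTHESES (as in leaf-09's files).  0∕4 row-D1 binders; (K) NOT closed; (J1) ONE OPEN ROW;
NOT D1, NEVER «G-an2-4 closed», NOT `BetaPertH`, NOT continuum, NOT Clay.

ABSOLUTE RULE (cell charter, verbatim): «No internally-minted statement may enter as a cited fact. Every hypothesis is either kernel-proved in this
package or a verbatim quotation of a PUBLISHED theorem with page reference. The manuscript(s) under audit are NOT citable for their own disputed
steps — they are the thing under adjudication; programme-internal (2001/route/tribunal) claims are never citable.»

Unit `b2b-balaban-beta-d1-p2` (road owner, gen 24), 2026-08-23; no existing file touched.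
-/

noncomputable section

namespace Summit.QuantumFields.BalabanUV.Beta.D1BFx.CombPairSlotLetters

open Finset
open scoped BigOperators
open Literature.MathematicalPhysics.QuantumFieldTheory.Balaban1983to89
open Literature.MathematicalPhysics.QuantumFieldTheory.Balaban1983to89.Beta
open ColourTrace (Complete TrOrthonormal)
open WilsonVertex2Sym (wsym22)
open WilsonBiStencil (wilsonW₂)
open StepJetData (wilsonA)
open InterLevelTransport (SLam)
open BalabanStepJets (lamCoeffOf)
open ExpKernelCalculus (MKer)
open OneStepResolventKernel (Fib KInv)
open KernelWard (divV)
open AveragingContoursRooted (ctr)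
open Summit.QuantumFields.BalabanUV.Beta.ChartConjugation (conjV)
open Summit.QuantumFields.BalabanUV.Beta.BorderedHessian (diagK conjV_diagK_apply bhK)
open Summit.QuantumFields.BalabanUV.Beta.DshAn1 (Dsh)
open Summit.QuantumFields.BalabanUV.Beta.AveragingWardRootedStencils (legInd)
open Summit.QuantumFields.BalabanUV.Beta.SymAveragingHessianCounts (symVhSAt symHessFFAt)
open Summit.QuantumFields.BalabanUV.Beta.SymSecondOrderTablesAn1 (symVh₂SAn1 symTablesAn1S2)
open Summit.QuantumFields.BalabanUV.Beta.CombChartStepJets (JsB12CombSh0)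
open Summit.QuantumFields.BalabanUV.Beta.CombFormSlotGaugeLetter (JsB12CombSh0_S_zero)
open Summit.QuantumFields.BalabanUV.Beta.CombLamSectorLetters (divV_SLam_lamCoeffOf_an1TablesS2_eq_zero)
open Summit.QuantumFields.BalabanUV.Beta.WardLocusQuartic (divV_smul)
open Summit.QuantumFields.BalabanUV.Beta.WilsonBiStencilWardZ (divV_wilsonW₂_wsym22_eq_conjV)
open Summit.QuantumFields.BalabanUV.Beta.WilsonBiStencilWardSocket (divV_wilsonW₂_wsym22_snd_eq_conjV)
open Summit.QuantumFields.BalabanUV.Beta.WilsonWardSocketFit (divV_wilsonW₂_smul_fst divV_wilsonW₂_smul_snd)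
open Summit.QuantumFields.BalabanUV.Beta.D1BFx.CombBorderPairSlotLetter (divV_apply_entry hL_border hR_border)
open Summit.QuantumFields.BalabanUV.Beta.D1BFx.ColumnGaugeCombPartner (divV_S_zero_eq_smul_conjV_leggedBorder)

variable {n : ℕ} [NeZero n] {N : ℕ} {C : Type*} [Fintype C] [DecidableEq C] {τ : C → Matrix (Fin N) (Fin N) ℂ}

/-! ## §0 Additivity of the divergence (entrywise, finite sums) -/

omit [NeZero n] in
/-- [folklore] `divV` is additive in the family. -/
theorem divV_add_family {d : ℕ} (V W : Fin (d + 1) → (Fin (d + 1) → ℤ) → MKer (d + 1) (Fib d)) (u₀ : Fin (d + 1) → ℤ) :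
    divV (fun κ u => V κ u + W κ u) u₀ = divV V u₀ + divV W u₀ := by
  funext x z a b
  simp only [divV_apply_entry, Pi.add_apply, ← Finset.sum_add_distrib]
  exact Finset.sum_congr rfl fun κ _ => by ring

/-! ## §1 The Wilson sector with the literal's table `(8N²)⁻¹ • wsym22 N` and weight `n⁸` -/

omit [NeZero n] in
/-- [folklore] **FIRST SLOT, WILSON SECTOR**: `divV (κ u ↦ n⁸ • wilsonW₂ 3 ((8N²)⁻¹•wsym22 N) κ u κ′ u′) u₀ = (n⁴∕2) • conjV (n⁴ • wilsonA 3 κ′ u′) (diagK (legInd ρ u₀))`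
(leaf-09's pointwise law at scalar `4N²`; `n⁸·(8N²)⁻¹·4N² = (n⁴∕2)·n⁴`). -/
theorem hL_wilson (hτ : Complete τ) (ho : TrOrthonormal τ) (hN : N ≠ 0) (c : C) (ρ : Fin 4 → ℤ) (κ' : Fin 4) (u' u₀ : Fin 4 → ℤ) :
    divV (fun κ u => ((n : ℝ) ^ 8) • wilsonW₂ 3 ((8 * (N : ℝ) ^ 2)⁻¹ • wsym22 N) κ u κ' u') u₀
      = ((n : ℝ) ^ 4 / 2) • conjV (((n : ℝ) ^ 4) • wilsonA 3 κ' u') (diagK (legInd ρ u₀)) := by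
  have hN' : (N : ℝ) ≠ 0 := Nat.cast_ne_zero.2 hN
  rw [divV_wilsonW₂_smul_fst, divV_wilsonW₂_wsym22_eq_conjV hτ ho hN c ρ u' κ' u₀, smul_smul]
  funext x z a b
  simp only [Pi.smul_apply, smul_eq_mul, conjV_diagK_apply]
  field_simp
  ring

omit [NeZero n] in
/-- [folklore] **SECOND SLOT, WILSON SECTOR**: `divV (n⁸ • wilsonW₂ 3 ((8N²)⁻¹•wsym22 N) κ u) u₀ = (n⁴∕2) • conjV (n⁴ • wilsonA 3 κ u) (diagK (legInd ρ u₀))`. -/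
theorem hR_wilson (hτ : Complete τ) (ho : TrOrthonormal τ) (hN : N ≠ 0) (c : C) (ρ : Fin 4 → ℤ) (κ : Fin 4) (u u₀ : Fin 4 → ℤ) :
    divV (fun κ' u' => ((n : ℝ) ^ 8) • wilsonW₂ 3 ((8 * (N : ℝ) ^ 2)⁻¹ • wsym22 N) κ u κ' u') u₀
      = ((n : ℝ) ^ 4 / 2) • conjV (((n : ℝ) ^ 4) • wilsonA 3 κ u) (diagK (legInd ρ u₀)) := by
  have hN' : (N : ℝ) ≠ 0 := Nat.cast_ne_zero.2 hN
  rw [divV_wilsonW₂_smul_snd, divV_wilsonW₂_wsym22_snd_eq_conjV hτ ho hN c ρ κ u u₀, smul_smul]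
  funext x z a b
  simp only [Pi.smul_apply, smul_eq_mul, conjV_diagK_apply]
  field_simp
  ring

/-! ## §2 The full pair table of the literal of record at lockB: `hL`, `hR` with `ξ = n⁴∕2`, `T = T′ = S♭` -/

/-- **`hL` FOR THE LITERAL OF RECORD's PAIR TABLE** [our object]: for `S₂⁰ κ u κ′ u′ := n⁸ • wilsonW₂ 3 ((8N²)⁻¹•wsym22 N) κ u κ′ u′ + (−n¹²∕4) • symVh₂SAn1 3 n κ u κ′ u′`
and `S♭ κ u := n⁴ • wilsonA 3 κ u + (−n⁸∕2) • symVhSAt ρ_c 3 n κ u`, at every second bond and varied site,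
`divV (κ u ↦ S₂⁰ κ u κ′ u′) u₀ = (n⁴∕2) • conjV (S♭ κ′ u′) (diagK (legInd ρ_c u₀))` — TT12's `hL` with `ξ₁ = n⁴∕2`, `T′ = S♭`. -/
theorem hL_record (hτ : Complete τ) (ho : TrOrthonormal τ) (hN : N ≠ 0) (c : C) (κ' : Fin 4) (u' u₀ : Fin 4 → ℤ) :
    divV (fun κ u => ((n : ℝ) ^ 8) • wilsonW₂ 3 ((8 * (N : ℝ) ^ 2)⁻¹ • wsym22 N) κ u κ' u' + (-((n : ℝ) ^ 12 / 4)) • symVh₂SAn1 3 n κ u κ' u') u₀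
      = ((n : ℝ) ^ 4 / 2) • conjV (((n : ℝ) ^ 4) • wilsonA 3 κ' u' + (-((n : ℝ) ^ 8 / 2)) • symVhSAt (ctr 4 n) 3 n rfl κ' u') (diagK (legInd (ctr 4 n) u₀)) := by
  rw [divV_add_family, hL_wilson hτ ho hN c (ctr 4 n) κ' u' u₀, hL_border κ' u' u₀]
  funext x z a b
  simp only [Pi.add_apply, Pi.smul_apply, smul_eq_mul, conjV_diagK_apply]
  ring

/-- **`hR` FOR THE LITERAL OF RECORD's PAIR TABLE** [our object]: `divV (S₂⁰ κ u) u₀ = (n⁴∕2) • conjV (S♭ κ u) (diagK (legInd ρ_c u₀))` — TT12's `hR`, `ξ₂ = n⁴∕2`, `T = S♭`. -/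
theorem hR_record (hτ : Complete τ) (ho : TrOrthonormal τ) (hN : N ≠ 0) (c : C) (κ : Fin 4) (u u₀ : Fin 4 → ℤ) :
    divV (fun κ' u' => ((n : ℝ) ^ 8) • wilsonW₂ 3 ((8 * (N : ℝ) ^ 2)⁻¹ • wsym22 N) κ u κ' u' + (-((n : ℝ) ^ 12 / 4)) • symVh₂SAn1 3 n κ u κ' u') u₀
      = ((n : ℝ) ^ 4 / 2) • conjV (((n : ℝ) ^ 4) • wilsonA 3 κ u + (-((n : ℝ) ^ 8 / 2)) • symVhSAt (ctr 4 n) 3 n rfl κ u) (diagK (legInd (ctr 4 n) u₀)) := by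
  rw [divV_add_family, hR_wilson hτ ho hN c (ctr 4 n) κ u u₀,
    show (fun κ' u' => (-((n : ℝ) ^ 12 / 4)) • symVh₂SAn1 3 n κ u κ' u') = (-((n : ℝ) ^ 12 / 4)) • symVh₂SAn1 3 n κ u from rfl, hR_border κ u u₀]
  funext x z a b
  simp only [Pi.add_apply, Pi.smul_apply, smul_eq_mul, conjV_diagK_apply]
  ring

/-! ## §3 `hT`: the first-order partner of `S♭` is the legged border (the Λ-sector of `S⁰` is gauge-null per site) -/

/-- **`hT` FOR `T′ = S♭`** [our object]: for `n` odd and the literal of record `JsB12CombSh0 hodd N (symTablesAn1S2 3 n cΛ) cΛ cB`,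
`divV S♭ u₀ = (n⁴∕2) • conjV (bhK n + Dsh n) (diagK (legInd ρ_c u₀))` — `S⁰ = S♭ + cΛ • SΛ` (`CombFormSlotGaugeLetter.JsB12CombSh0_S_zero`), `divV SΛ = 0`
(`CombLamSectorLetters.divV_SLam_lamCoeffOf_an1TablesS2_eq_zero`), and `ColumnGaugeCombPartner.divV_S_zero_eq_smul_conjV_leggedBorder`. -/
theorem hT_record (hodd : Odd n) (Ncol : ℕ) (cΛ cB : ℝ) (u₀ : Fin 4 → ℤ) :
    divV (fun κ u => ((n : ℝ) ^ 4) • wilsonA 3 κ u + (-((n : ℝ) ^ 8 / 2)) • symVhSAt (ctr 4 n) 3 n rfl κ u) u₀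
      = ((n : ℝ) ^ 4 / 2) • conjV (bhK n + Dsh n) (diagK (legInd (ctr 4 n) u₀)) := by
  have hS := JsB12CombSh0_S_zero hodd Ncol (symTablesAn1S2 3 n cΛ) cΛ cB
  have hfull := divV_S_zero_eq_smul_conjV_leggedBorder hodd Ncol cΛ cB u₀
  rw [hS] at hfull
  have hΛ := divV_SLam_lamCoeffOf_an1TablesS2_eq_zero (d := 3) (Lc := n) cΛ u₀
  -- split the full member's divergence: pure part + `cΛ •` the (null) Λ-sector
  have hsplit : divV (fun κ u => ((n : ℝ) ^ 4) • wilsonA 3 κ u + (-((n : ℝ) ^ 8 / 2)) • (symTablesAn1S2 3 n cΛ).V κ u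
        + cΛ • SLam n (lamCoeffOf (KInv (N := n) (d := 3)) n) (symTablesAn1S2 3 n cΛ).H κ u) u₀
      = divV (fun κ u => ((n : ℝ) ^ 4) • wilsonA 3 κ u + (-((n : ℝ) ^ 8 / 2)) • symVhSAt (ctr 4 n) 3 n rfl κ u) u₀
        + cΛ • divV (SLam n (lamCoeffOf (KInv (N := n) (d := 3)) n) (symHessFFAt (ctr (3 + 1) n) n)) u₀ := by
    rw [divV_add_family, divV_smul]
    rfl
  rw [hsplit, hΛ, smul_zero, add_zero] at hfull
  exact hfull

end Summit.QuantumFields.BalabanUV.Beta.D1BFx.CombPairSlotLetters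

end
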